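import Summits.ABC.ABC.Theorems.CuspFieldPencilGoldenFromNFPencil
import Summits.ABC.ABC.Theorems.PlacewiseSzpiroSingleTowerSzpiroBakerSinglePlace
import Literature.Barriers.ABC.BakerMethodBoundsThreeRoutesProofs
import Literature.Barriers.ABC.BakerMethodBoundsStewartYuProofs
import Literature.Barriers.ABC.BakerMethodBoundsStewartTijdemanProofs
import HarnessLib
import Summits.ABC.ABC.Theses.CuspFieldPencil
import Summits.ABC.ABC.Theorems.YuMatveevShapeRatCloses

/-!
# LANDING BUNDLE (planner sidea-k1-g5 preflight) — crux X1 `GoldenCuspShadow` (stmt-ABC-26026), UNCONDITIONAL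

This single file elaborates as is (it is the concatenation of the three ≤ 400-line Theorems files a prover should
propose IN ORDER; parts 2 and 3 import part 1 / part 2, which is why they cannot be farm-checked separately before part 1 lands).
Source: `Cruxes/GoldenCuspShadow/STUB_IDEAS_stub_splitCuspTriple_3_g5_Sketch.lean` (`SplitK3G5`, sorry-free, axioms standard);
changes: namespace `Summit.ABC.ABC.Theorems.CuspFieldPencilGoldenCuspShadow`, orphans `tU/Q_swap/prod_swap/stub_splitCuspTriple` and
the `example`s dropped, `goldenCuspShadow_of_cuspMinRadBound` inlined into the final `Summit.ABC.ABC.Theorems.goldenCuspShadow_proof`,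
unused binder renamed. Preflight (`ledger propose --dry-run`, part 1): verdict QUEUED (D-0009 review of the transparent `abbrev`s /
`def … : Prop` targets; `lint.theses-cone` warning only). See `STUB-IDEAS-stub_conjugateCuspTriple-1.md` §1 for the exact commands.
-/

/-! ===== LANDING PART 1/3 — target `Summits/ABC/ABC/Theorems/CuspFieldPencilGoldenCuspShadowObjects.lean` — its own header is exactly:
    import Summits.ABC.ABC.Theorems.CuspFieldPencilGoldenFromNFPencil
    import Summits.ABC.ABC.Theorems.PlacewiseSzpiroSingleTowerSzpiroBakerSinglePlace
    import Literature.Barriers.ABC.BakerMethodBoundsThreeRoutesProofs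
    import Literature.Barriers.ABC.BakerMethodBoundsStewartYuProofs
    import Literature.Barriers.ABC.BakerMethodBoundsStewartTijdemanProofs
    import HarnessLib
===== (cut here; everything down to the next PART marker is the file body) -/

/-!
# Crux X1 `GoldenCuspShadow` (stmt-ABC-26026, route `CuspFieldPencil`) — part 1/3: targets, endgame, objects

Landing split (≤ 400 lines per Theorems file) of the kernel-closed crux workfile
`Summits/ABC/ABC/Cruxes/GoldenCuspShadow/STUB_IDEAS_stub_splitCuspTriple_3_g5_Sketch.lean` (ideator `SplitK3G5`,
2026-08-31; statements = `SplitK2G5` cut). Statements and proofs verbatim (the integer bookkeeping `GoldenFromNFPencil.*` is reused, not restated).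
Contents: the one-cusp targets `RouteU` / `RouteW`, the min-form `CuspMinRadBound`, the split-stub text `StubSplit`;
the abstract self-improvement `endgame_abstract`; the objects `Q, H, ξ₀, Θ₀, Y, R` and `R = rad u · rad w · rad Q`.
-/

set_option linter.dupNamespace false

noncomputable section

open Finset Real Height
open Literature.NumberTheory.DiophantineGeometry
open Literature.NumberTheory.DiophantineGeometry.Dioph
open Literature.NumberTheory.DiophantineGeometry.Pasten
open Literature.Barriers.ABC
open Summit.ABC.ABC.Theorems

namespace Summit.ABC.ABC.Theorems

namespace CuspFieldPencilGoldenCuspShadow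

/-! ## 0 · The stub (verbatim), the two one-cusp targets, the min-form -/

/-- The registered stub signature `stub_splitCuspTriple`, verbatim. -/
def StubSplit : Prop :=
  ∀ ε : ℝ, 0 < ε → ∃ κ : ℝ, ∀ u w : ℤ, IsCoprime u w → u * w * (u ^ 2 - 11 * u * w - w ^ 2) ≠ 0 → Real.log (max (|(u : ℝ)|) (|(w : ℝ)|)) ≤ κ * (((UniqueFactorizationMonoid.radical (u * w * (u ^ 2 - 11 * u * w - w ^ 2))).natAbs : ℕ) : ℝ) ^ (ε : ℝ) * (((((UniqueFactorizationMonoid.radical u).natAbs : ℕ) : ℝ) * (((UniqueFactorizationMonoid.radical w).natAbs : ℕ) : ℝ)) ^ (2 / 3 : ℝ) * (((UniqueFactorizationMonoid.radical (u ^ 2 - 11 * u * w - w ^ 2)).natAbs : ℕ) : ℝ) ^ (1 / 3 : ℝ))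

/-- ONE-CUSP TARGET at the cusp `t = 0`: `log max(|u|,|w|) ≤ κ_ε · rad(uwQ)^ε · rad u`. -/
def RouteU : Prop :=
  ∀ ε : ℝ, 0 < ε → ∃ κ : ℝ, ∀ u w : ℤ, IsCoprime u w → u * w * (u ^ 2 - 11 * u * w - w ^ 2) ≠ 0 →
    Real.log (max (|(u : ℝ)|) (|(w : ℝ)|)) ≤
      κ * (((UniqueFactorizationMonoid.radical (u * w * (u ^ 2 - 11 * u * w - w ^ 2))).natAbs : ℕ) : ℝ) ^ (ε : ℝ) *
        (((UniqueFactorizationMonoid.radical u).natAbs : ℕ) : ℝ)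

/-- ONE-CUSP TARGET at the cusp `t = ∞`: `log max(|u|,|w|) ≤ κ_ε · rad(uwQ)^ε · rad w`. -/
def RouteW : Prop :=
  ∀ ε : ℝ, 0 < ε → ∃ κ : ℝ, ∀ u w : ℤ, IsCoprime u w → u * w * (u ^ 2 - 11 * u * w - w ^ 2) ≠ 0 →
    Real.log (max (|(u : ℝ)|) (|(w : ℝ)|)) ≤
      κ * (((UniqueFactorizationMonoid.radical (u * w * (u ^ 2 - 11 * u * w - w ^ 2))).natAbs : ℕ) : ℝ) ^ (ε : ℝ) *
        (((UniqueFactorizationMonoid.radical w).natAbs : ℕ) : ℝ)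

/-- The min-form: `log max(|u|,|w|) ≤ κ_ε · rad(uwQ)^ε · min(rad u, rad w)`. -/
def CuspMinRadBound : Prop :=
  ∀ ε : ℝ, 0 < ε → ∃ κ : ℝ, ∀ u w : ℤ, IsCoprime u w → u * w * (u ^ 2 - 11 * u * w - w ^ 2) ≠ 0 →
    Real.log (max (|(u : ℝ)|) (|(w : ℝ)|)) ≤
      κ * (((UniqueFactorizationMonoid.radical (u * w * (u ^ 2 - 11 * u * w - w ^ 2))).natAbs : ℕ) : ℝ) ^ (ε : ℝ) *
        min ((((UniqueFactorizationMonoid.radical u).natAbs : ℕ) : ℝ))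
            ((((UniqueFactorizationMonoid.radical w).natAbs : ℕ) : ℝ))

/-! ## 1 · FILE B (pure analysis): the ABSTRACT ENDGAME — PROVED here -/

/-- **ENDGAME (abstract self-improvement; no number theory).**  For non-negative reals `y i` with
`1 ≤ m i ≤ R i`: if for every `η > 0` there is `A` with `y i ≤ A · (R i)^η · m i · log max(e, 2 y i)`,
then for every `ε > 0` there is `κ` with `y i ≤ κ · (R i)^ε · m i`.
Proof: `η := min ε 1 / 3`, `A' := max A 1`, `M := A' R^η m ≥ 1`; `le_of_le_mul_log_max` ⇒ `y ≤ 2M log(4M)`;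
`Real.log_le_rpow_div` ⇒ `log(4M) ≤ (4M)^η/η ≤ 4 M^η/η`; `M^η ≤ A' R^{η²} R^η` (`m^η ≤ R^η`);
`η + η² + η ≤ 3η ≤ ε`; `κ := 8A'²/η`. -/
theorem endgame_abstract {ι : Type*} {y R m : ι → ℝ}
    (_hy : ∀ i, 0 ≤ y i) (hR : ∀ i, 1 ≤ R i) (hm : ∀ i, 1 ≤ m i) (hmR : ∀ i, m i ≤ R i)
    (hpre : ∀ η : ℝ, 0 < η → ∃ A : ℝ, ∀ i,
      y i ≤ A * R i ^ η * m i * Real.log (max (Real.exp 1) (2 * y i))) :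
    ∀ ε : ℝ, 0 < ε → ∃ κ : ℝ, ∀ i, y i ≤ κ * R i ^ ε * m i := by
  intro ε hε
  obtain ⟨η, hηdef⟩ : ∃ η : ℝ, η = min ε 1 / 3 := ⟨_, rfl⟩
  have hη0 : 0 < η := by rw [hηdef]; have := lt_min hε one_pos; linarith
  have hη1 : η ≤ 1 / 3 := by rw [hηdef]; have := min_le_right ε 1; linarith
  have h3η : 3 * η ≤ ε := by rw [hηdef]; have := min_le_left ε 1; linarith
  obtain ⟨A, hA⟩ := hpre η hη0
  obtain ⟨A', hA'def⟩ : ∃ A' : ℝ, A' = max A 1 := ⟨_, rfl⟩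
  have hA'1 : 1 ≤ A' := by rw [hA'def]; exact le_max_right _ _
  have hAA : A ≤ A' := by rw [hA'def]; exact le_max_left _ _
  have hA'0 : 0 ≤ A' := zero_le_one.trans hA'1
  refine ⟨8 * A' ^ 2 / η, fun i => ?_⟩
  have hRi := hR i
  have hmi := hm i
  have hmRi := hmR i
  have hR0 : 0 < R i := by linarith
  have hm0 : 0 ≤ m i := by linarith
  have hRη0 : 0 ≤ R i ^ η := Real.rpow_nonneg hR0.le _
  have hRη : 1 ≤ R i ^ η := Real.one_le_rpow hRi hη0.le
  have hL : 1 ≤ Real.log (max (Real.exp 1) (2 * y i)) := one_le_log_max_exp _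
  have hL0 : 0 ≤ Real.log (max (Real.exp 1) (2 * y i)) := zero_le_one.trans hL
  obtain ⟨M, hM⟩ : ∃ M : ℝ, M = A' * R i ^ η * m i := ⟨_, rfl⟩
  have hM1 : 1 ≤ M := by
    rw [hM]
    calc (1 : ℝ) = 1 * 1 * 1 := by ring
      _ ≤ A' * R i ^ η * m i :=
        mul_le_mul (mul_le_mul hA'1 hRη zero_le_one hA'0) hmi zero_le_one (mul_nonneg hA'0 hRη0)
  have hM0 : 0 < M := by linarith
  -- `y ≤ M · log max(e, 2y)`
  have h1 : y i ≤ M * Real.log (max (Real.exp 1) (2 * y i)) := by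
    have hX : 0 ≤ R i ^ η * m i * Real.log (max (Real.exp 1) (2 * y i)) :=
      mul_nonneg (mul_nonneg hRη0 hm0) hL0
    calc y i ≤ A * R i ^ η * m i * Real.log (max (Real.exp 1) (2 * y i)) := hA i
      _ = A * (R i ^ η * m i * Real.log (max (Real.exp 1) (2 * y i))) := by ring
      _ ≤ A' * (R i ^ η * m i * Real.log (max (Real.exp 1) (2 * y i))) :=
        mul_le_mul_of_nonneg_right hAA hX
      _ = M * Real.log (max (Real.exp 1) (2 * y i)) := by rw [hM]; ring
  -- self-improvement
  have h2 : y i ≤ 2 * M * Real.log (4 * M) := le_of_le_mul_log_max hM1 h1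
  -- `log(4M) ≤ (4M)^η / η ≤ 4 M^η / η`
  have h3 : Real.log (4 * M) ≤ (4 * M) ^ η / η := Real.log_le_rpow_div (by linarith) hη0
  have hMη0 : 0 ≤ M ^ η := Real.rpow_nonneg hM0.le _
  have h4 : (4 * M) ^ η ≤ 4 * M ^ η := by
    rw [Real.mul_rpow (by norm_num) hM0.le]
    have h44 : (4 : ℝ) ^ η ≤ 4 := by
      calc (4 : ℝ) ^ η ≤ (4 : ℝ) ^ (1 : ℝ) :=
            Real.rpow_le_rpow_of_exponent_le (by norm_num) (by linarith)
        _ = 4 := Real.rpow_one _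
    exact mul_le_mul_of_nonneg_right h44 hMη0
  -- `M^η ≤ A' · R^{η η} · R^η`
  have h5 : M ^ η ≤ A' * (R i ^ (η * η) * R i ^ η) := by
    have e1 : A' ^ η ≤ A' := by
      calc A' ^ η ≤ A' ^ (1 : ℝ) := Real.rpow_le_rpow_of_exponent_le hA'1 (by linarith)
        _ = A' := Real.rpow_one _
    have e2 : m i ^ η ≤ R i ^ η := Real.rpow_le_rpow hm0 hmRi hη0.le
    have e3 : (R i ^ η) ^ η = R i ^ (η * η) := (Real.rpow_mul hR0.le η η).symm
    have hRηη0 : 0 ≤ R i ^ (η * η) := Real.rpow_nonneg hR0.le _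
    rw [hM, Real.mul_rpow (mul_nonneg hA'0 hRη0) hm0, Real.mul_rpow hA'0 hRη0, e3]
    calc A' ^ η * R i ^ (η * η) * m i ^ η ≤ A' * R i ^ (η * η) * R i ^ η :=
          mul_le_mul (mul_le_mul_of_nonneg_right e1 hRηη0) e2 (Real.rpow_nonneg hm0 _)
            (mul_nonneg hA'0 hRηη0)
      _ = A' * (R i ^ (η * η) * R i ^ η) := by ring
  -- exponents: `η + (η η + η) ≤ ε`
  have h6 : R i ^ η * (R i ^ (η * η) * R i ^ η) ≤ R i ^ ε := by
    rw [← Real.rpow_add hR0, ← Real.rpow_add hR0]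
    apply Real.rpow_le_rpow_of_exponent_le hRi
    nlinarith [mul_le_mul_of_nonneg_left hη1 hη0.le]
  -- assemble
  have hM2 : 0 ≤ 2 * M := by linarith
  have h8η : 0 ≤ 8 / η := div_nonneg (by norm_num) hη0.le
  calc y i ≤ 2 * M * Real.log (4 * M) := h2
    _ ≤ 2 * M * ((4 * M) ^ η / η) := mul_le_mul_of_nonneg_left h3 hM2
    _ ≤ 2 * M * ((4 * M ^ η) / η) :=
        mul_le_mul_of_nonneg_left (div_le_div_of_nonneg_right h4 hη0.le) hM2
    _ = (8 / η) * (M * M ^ η) := by ring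
    _ ≤ (8 / η) * (M * (A' * (R i ^ (η * η) * R i ^ η))) :=
        mul_le_mul_of_nonneg_left (mul_le_mul_of_nonneg_left h5 hM0.le) h8η
    _ = 8 * A' ^ 2 / η * (R i ^ η * (R i ^ (η * η) * R i ^ η)) * m i := by rw [hM]; ring
    _ ≤ 8 * A' ^ 2 / η * R i ^ ε * m i := by
        apply mul_le_mul_of_nonneg_right _ hm0
        exact mul_le_mul_of_nonneg_left h6 (div_nonneg (by positivity) hη0.le)

/-! ## 2 · Objects (abbreviations only) and ring identities -/



/-- `Q(u,w) = u² − 11uw − w²`. -/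
abbrev Q (u w : ℤ) : ℤ := u ^ 2 - 11 * u * w - w ^ 2

/-- `H(u,w) = max(|u|,|w|)` as a real number. -/
abbrev H (u w : ℤ) : ℝ := max |(u : ℝ)| |(w : ℝ)|

/-- The linearised variable `y = log(13·H²)`. -/
abbrev Ylin (u w : ℤ) : ℝ := Real.log (13 * H u w ^ 2)

/-- `sign z` as a rational number. -/
abbrev sgn (z : ℤ) : ℚ := ((Int.sign z : ℤ) : ℚ)

/-- THE ONE RATIO `ξ₀ = −Q/w²` in the `approx_div` shape `ζ · (x : ℚ)/y`, `x = |Q|`, `y = |w|²`, `ζ = −sign Q`. -/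
abbrev xiU (u w : ℤ) : ℚ := (-sgn (Q u w)) * ((((Q u w).natAbs : ℕ) : ℚ) / ((w.natAbs ^ 2 : ℕ) : ℚ))

/-- `Θ₀ = theta K |Q| |w|² 0`. -/
abbrev Th (K : ℝ) (u w : ℤ) : ℝ := theta K (Q u w).natAbs (w.natAbs ^ 2) 0

/-- `Y = log max(e, h(ξ₀))`. -/
abbrev Yxi (u w : ℤ) : ℝ := Real.log (max (Real.exp 1) (logHeight₁ (xiU u w)))

/-- `R = rad(u·w·Q)` as a real number. -/
abbrev Rr (u w : ℤ) : ℝ := (((UniqueFactorizationMonoid.radical (u * w * Q u w)).natAbs : ℕ) : ℝ)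

/-- `rad z` as a real number. -/
abbrev radR (z : ℤ) : ℝ := (((UniqueFactorizationMonoid.radical z).natAbs : ℕ) : ℝ)


/-- H0 (proved): `rad z`, as a real, is the product of the rational primes of `z`. -/
theorem natAbs_radical_cast (z : ℤ) : radR z = ∏ p ∈ z.natAbs.primeFactors, (p : ℝ) := by
  simp only [radR]
  rw [← Int.radical_natAbs_eq_radical, Int.natAbs_natCast, Nat.radical_eq_prod_primeFactors, Nat.cast_prod]

/-- H0' (proved): `(rad z).natAbs = rad |z|` in `ℕ`. -/
theorem natAbs_radical (z : ℤ) :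
    (UniqueFactorizationMonoid.radical z).natAbs = UniqueFactorizationMonoid.radical z.natAbs := by
  rw [← Int.radical_natAbs_eq_radical, Int.natAbs_natCast]

/-- H1 (proved): `1 ≤ rad z` as a real. -/
theorem one_le_radR (z : ℤ) : 1 ≤ radR z := by
  simp only [radR]
  exact_mod_cast Int.natAbs_pos.mpr (UniqueFactorizationMonoid.radical_ne_zero (a := z))

/-- H2 (proved): `R = rad u · rad w · rad Q` for coprime `u, w` (`natAbs_radical_prod`). -/
theorem Rr_eq {u w : ℤ} (h : IsCoprime u w) : Rr u w = radR u * radR w * radR (Q u w) := by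
  simp only [Rr, radR, Q]
  rw [GoldenFromNFPencil.natAbs_radical_prod h]
  push_cast
  ring


end CuspFieldPencilGoldenCuspShadow

end Summit.ABC.ABC.Theorems

end


/-! ===== LANDING PART 2/3 — target `Summits/ABC/ABC/Theorems/CuspFieldPencilGoldenCuspShadowCall.lean` — its own header is exactly:
    import Summits.ABC.ABC.Theorems.CuspFieldPencilGoldenCuspShadowObjects
    import HarnessLib
===== (cut here; everything down to the next PART marker is the file body) -/

/-!
# Crux X1 `GoldenCuspShadow` — part 2/3: the ONE `Pasten.approx_div` call at `ξ₀ = −Q/w²` and the absorption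

`T₀ : w² + Q = u(u − 11w)`, `1 − ξ₀ = u(u−11w)/w²`; p-adic clause at `p ∣ u` only ⇒ `log|u| ≤ 3Θ₀YΣ_{p∣u}p`;
archimedean clause ⇒ `log H ≤ log|u| + log 12 + Θ₀Y`; `h(ξ₀) ≤ 2y`; `Θ₀ ≤ K·C·R^η`; `1 + 3Σ_{p∣u} p ≤ 4 rad u`.
Verbatim from the `SplitK3G5` crux workfile.
-/

set_option linter.dupNamespace false

noncomputable section

open Finset Real Height
open Literature.NumberTheory.DiophantineGeometry
open Literature.NumberTheory.DiophantineGeometry.Dioph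
open Literature.NumberTheory.DiophantineGeometry.Pasten
open Literature.Barriers.ABC
open Summit.ABC.ABC.Theorems

namespace Summit.ABC.ABC.Theorems

namespace CuspFieldPencilGoldenCuspShadow

/-! ## 3 · FILE A (number theory): the ONE call and its two clauses -/

/-- A1 (proved): `ζ = −sign Q = ±1` for `Q ≠ 0`. -/
theorem neg_sgn_cases {z : ℤ} (hz : z ≠ 0) : (-sgn z = 1 ∨ -sgn z = -1) := by
  rcases lt_or_gt_of_ne hz with h | h
  · left; simp [sgn, Int.sign_eq_neg_one_of_neg h]
  · right; simp [sgn, Int.sign_eq_one_of_pos h]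

/-- cast helper (proved): `sign z · |z| = z` in `ℚ`. -/
theorem sgn_mul_natAbs_cast (z : ℤ) : sgn z * ((z.natAbs : ℕ) : ℚ) = (z : ℚ) := by
  show ((Int.sign z : ℤ) : ℚ) * ((z.natAbs : ℕ) : ℚ) = (z : ℚ)
  rw [Nat.cast_natAbs, Int.cast_abs]
  exact_mod_cast Int.sign_mul_abs z

/-- cast helper (proved): `|w|² = w²` in `ℚ`. -/
theorem natAbs_sq_cast (w : ℤ) : ((w.natAbs ^ 2 : ℕ) : ℚ) = (w : ℚ) ^ 2 := by
  rw [Nat.cast_pow, Nat.cast_natAbs, Int.cast_abs, sq_abs]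

/-- A2' (proved): `ξ₀ = −Q/w²`. -/
theorem xiU_eq (u w : ℤ) : xiU u w = -((Q u w : ℤ) : ℚ) / (w : ℚ) ^ 2 := by
  show (-sgn (Q u w)) * ((((Q u w).natAbs : ℕ) : ℚ) / ((w.natAbs ^ 2 : ℕ) : ℚ)) = _
  rw [natAbs_sq_cast, ← sgn_mul_natAbs_cast (Q u w)]
  ring

/-- A2 (proved): `1 − ξ₀ = u(u − 11w)/w²`. -/
theorem one_sub_xiU {u w : ℤ} (hw : w ≠ 0) :
    1 - xiU u w = ((u : ℚ) * (u - 11 * w)) / (w : ℚ) ^ 2 := by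
  have hw' : (w : ℚ) ^ 2 ≠ 0 := pow_ne_zero _ (Int.cast_ne_zero.mpr hw)
  have hQc : ((Q u w : ℤ) : ℚ) = (u : ℚ) ^ 2 - 11 * (u : ℚ) * (w : ℚ) - (w : ℚ) ^ 2 := by
    simp only [Q]; push_cast; ring
  rw [xiU_eq, eq_div_iff hw', sub_mul, div_mul_cancel₀ _ hw', one_mul]
  rw [hQc]
  ring

/-- E1 (proved): the cusp-0 escape `u = 11w` forces `(u, w) = ±(11, 1)`, so `H = 11`. -/
theorem escape_u {u w : ℤ} (h : IsCoprime u w) (he : u - 11 * w = 0) : H u w = 11 := by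
  have hu : u = 11 * w := by linarith
  have hdvd : w ∣ u := by rw [hu]; exact Dvd.intro_left 11 rfl
  have hw : IsUnit w := h.isUnit_of_dvd' hdvd dvd_rfl
  have hw1 : |(w : ℝ)| = 1 := by
    rcases Int.isUnit_iff.mp hw with rfl | rfl <;> norm_num
  have hu1 : |(u : ℝ)| = 11 := by
    rw [hu, Int.cast_mul, abs_mul, hw1]; norm_num
  show max |(u : ℝ)| |(w : ℝ)| = 11
  rw [hu1, hw1, max_eq_left (by norm_num : (1 : ℝ) ≤ 11)]

/-- no integer solves `u(u − 11) = 2` (discriminant `129` is not a square). -/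
theorem no_int_root (u : ℤ) (h : u * (u - 11) = 2) : False := by
  rcases le_or_gt u (-1) with h1 | h1
  · nlinarith [mul_nonneg (by linarith : (0:ℤ) ≤ -1 - u) (by linarith : (0:ℤ) ≤ 11 - u)]
  rcases le_or_gt u 11 with h2 | h2
  · nlinarith [mul_nonneg (by omega : (0:ℤ) ≤ u) (by omega : (0:ℤ) ≤ 11 - u)]
  · nlinarith [mul_nonneg (by omega : (0:ℤ) ≤ u - 12) (by omega : (0:ℤ) ≤ u)]

/-- E3 (proved): `x·y > 1`: `|Q|·w² = 1` would force `w = ±1`, `u(u ∓ 11) ∈ {0, 2}` — `0` is the escape,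
`2` is insoluble. -/
theorem one_lt_xy_u {u w : ℤ} (h0 : u * w * Q u w ≠ 0) (hne : u - 11 * w ≠ 0) :
    1 < (Q u w).natAbs * w.natAbs ^ 2 := by
  obtain ⟨huw, hQ⟩ := mul_ne_zero_iff.mp h0
  obtain ⟨hu, hw⟩ := mul_ne_zero_iff.mp huw
  have hQ1 : 1 ≤ (Q u w).natAbs := Int.natAbs_pos.mpr hQ
  have hw1 : 1 ≤ w.natAbs := Int.natAbs_pos.mpr hw
  by_contra hcon'
  have hcon : (Q u w).natAbs * w.natAbs ^ 2 ≤ 1 := not_lt.mp hcon'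
  have hQe : (Q u w).natAbs = 1 := by
    have : (Q u w).natAbs ≤ (Q u w).natAbs * w.natAbs ^ 2 :=
      Nat.le_mul_of_pos_right _ (by positivity)
    omega
  have hwe : w.natAbs = 1 := by
    have : w.natAbs ^ 2 ≤ (Q u w).natAbs * w.natAbs ^ 2 := Nat.le_mul_of_pos_left _ hQ1
    nlinarith
  have hw' : w = 1 ∨ w = -1 := Int.isUnit_iff.mp (Int.isUnit_iff_natAbs_eq.mpr hwe)
  have hQ' : Q u w = 1 ∨ Q u w = -1 := Int.isUnit_iff.mp (Int.isUnit_iff_natAbs_eq.mpr hQe)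
  simp only [Q] at hQ'
  rcases hw' with rfl | rfl <;> rcases hQ' with hq | hq
  · exact no_int_root u (by linear_combination hq)
  · have hm : u * (u - 11) = 0 := by linear_combination hq
    rcases mul_eq_zero.mp hm with h | h
    · exact hu h
    · exact hne (by linarith)
  · exact no_int_root (-u) (by linear_combination hq)
  · have hm : u * (u + 11) = 0 := by linear_combination hq
    rcases mul_eq_zero.mp hm with h | h
    · exact hu h
    · exact hne (by linarith)

/-- E5 (proved): `gcd(|Q|, |w|²) = 1` (`GoldenFromNFPencil.isCoprime_quadForm_right`). -/
theorem coprime_xy_u {u w : ℤ} (h : IsCoprime u w) : ((Q u w).natAbs).Coprime (w.natAbs ^ 2) := by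
  have h1 : IsCoprime (Q u w) w := (GoldenFromNFPencil.isCoprime_quadForm_right h).symm
  exact (Int.isCoprime_iff_nat_coprime.mp h1).pow_right 2

/-- E6 (proved): `ξ₀ ≠ 1` off the escape. -/
theorem xiU_ne_one {u w : ℤ} (h0 : u * w * Q u w ≠ 0) (hne : u - 11 * w ≠ 0) : xiU u w ≠ 1 := by
  obtain ⟨huw, _⟩ := mul_ne_zero_iff.mp h0
  obtain ⟨hu, hw⟩ := mul_ne_zero_iff.mp huw
  intro h1
  have h2 := one_sub_xiU (u := u) hw
  rw [h1, sub_self] at h2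
  have h3 : ((u : ℚ) * (u - 11 * w)) / (w : ℚ) ^ 2 ≠ 0 := by
    apply div_ne_zero
    · exact mul_ne_zero (Int.cast_ne_zero.mpr hu) (by exact_mod_cast hne)
    · exact pow_ne_zero _ (Int.cast_ne_zero.mpr hw)
  exact h3 h2.symm

/-- C0 (proved — the ONE CALL): both clauses of `Pasten.approx_div` for `ξ₀`, with `Θ₀ = Th K u w`. -/
theorem cusp0_call {K : ℝ} (hK : 1 ≤ K) (hP : PastenApproximationBound K) {u w : ℤ}
    (h : IsCoprime u w) (h0 : u * w * Q u w ≠ 0) (hne : u - 11 * w ≠ 0) :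
    (-Real.log |((1 - xiU u w : ℚ) : ℝ)| < Th K u w * Yxi u w) ∧
    ∀ p : ℕ, p.Prime → (padicValRat p (1 - xiU u w) : ℝ) * Real.log p <
        Th K u w * ((p / Real.log p) * Real.log (max (Real.exp 1) (p * logHeight₁ (xiU u w)))) := by
  obtain ⟨huw, hQ⟩ := mul_ne_zero_iff.mp h0
  obtain ⟨_, hw⟩ := mul_ne_zero_iff.mp huw
  have hx : (Q u w).natAbs ≠ 0 := Int.natAbs_ne_zero.mpr hQ
  have hy : w.natAbs ^ 2 ≠ 0 := pow_ne_zero _ (Int.natAbs_ne_zero.mpr hw)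
  exact approx_div hK hP hx hy (coprime_xy_u h) (one_lt_xy_u h0 hne) 0 (neg_sgn_cases hQ)
    (xiU_ne_one h0 hne)

/-- P1 (proved): for `p ∣ u`: `ν_p(u) ≤ ν_p(u) + ν_p(u − 11w) = ord_p(1 − ξ₀)` (`p ∤ w` by coprimality). -/
theorem factorization_le_padicValRat_xiU {u w : ℤ} (h : IsCoprime u w) (h0 : u * w * Q u w ≠ 0)
    (hne : u - 11 * w ≠ 0) {p : ℕ} (hp : p ∈ u.natAbs.primeFactors) :
    ((u.natAbs.factorization p : ℕ) : ℝ) ≤ ((padicValRat p (1 - xiU u w) : ℤ) : ℝ) := by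
  obtain ⟨huw, _⟩ := mul_ne_zero_iff.mp h0
  obtain ⟨hu, hw⟩ := mul_ne_zero_iff.mp huw
  have hpp : p.Prime := Nat.prime_of_mem_primeFactors hp
  haveI : Fact p.Prime := ⟨hpp⟩
  have hpu : p ∣ u.natAbs := Nat.dvd_of_mem_primeFactors hp
  have hpw : ¬ (p : ℤ) ∣ w := by
    intro hd
    have hd' : (p : ℤ) ∣ u := Int.natCast_dvd.mpr hpu
    have hunit : IsUnit (p : ℤ) := h.isUnit_of_dvd' hd' hd
    rw [Int.isUnit_iff_natAbs_eq, Int.natAbs_natCast] at hunit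
    exact hpp.one_lt.ne' hunit
  have hu' : (u : ℚ) ≠ 0 := by exact_mod_cast hu
  have hm' : ((u - 11 * w : ℤ) : ℚ) ≠ 0 := by exact_mod_cast hne
  have hw' : (w : ℚ) ≠ 0 := by exact_mod_cast hw
  have e : ((u : ℚ) * (u - 11 * w)) / (w : ℚ) ^ 2 = ((u : ℚ) * ((u - 11 * w : ℤ) : ℚ)) / (w : ℚ) ^ 2 := by
    push_cast; ring
  rw [one_sub_xiU hw, e, padicValRat.div (mul_ne_zero hu' hm') (pow_ne_zero _ hw'),
    padicValRat.mul hu' hm', padicValRat.pow]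
  simp only [padicValRat.of_int, padicValInt.eq_zero_of_not_dvd hpw]
  have e2 : u.natAbs.factorization p = padicValInt p u := by
    rw [Nat.factorization_def _ hpp]; rfl
  rw [e2]
  push_cast
  have : (0 : ℝ) ≤ (padicValInt p (u - 11 * w) : ℝ) := Nat.cast_nonneg _
  linarith

/-- P2 (proved, generic): `log|u| = ∑_{p∣u} ν_p(u) log p` against a prime-by-prime bound. -/
theorem log_natAbs_le_of_padic {u : ℤ} (hu : u ≠ 0) {ξ : ℚ} {Θ : ℝ} {F : ℕ → ℝ}
    (hval : ∀ p ∈ u.natAbs.primeFactors,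
      ((u.natAbs.factorization p : ℕ) : ℝ) ≤ ((padicValRat p (1 - ξ) : ℤ) : ℝ))
    (hbd : ∀ p : ℕ, p.Prime → ((padicValRat p (1 - ξ) : ℤ) : ℝ) * Real.log p < Θ * F p) :
    Real.log |(u : ℝ)| ≤ Θ * ∑ p ∈ u.natAbs.primeFactors, F p := by
  have e : ((u.natAbs : ℕ) : ℝ) = |(u : ℝ)| := by rw [Nat.cast_natAbs, Int.cast_abs]
  rw [← e, log_eq_sum_factorization_mul_log (Int.natAbs_ne_zero.mpr hu), Finset.mul_sum]
  apply Finset.sum_le_sum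
  intro p hp
  have hpp := Nat.prime_of_mem_primeFactors hp
  have hlog : 0 ≤ Real.log p := Real.log_nonneg (by exact_mod_cast hpp.one_lt.le)
  calc ((u.natAbs.factorization p : ℕ) : ℝ) * Real.log p
      ≤ ((padicValRat p (1 - ξ) : ℤ) : ℝ) * Real.log p := mul_le_mul_of_nonneg_right (hval p hp) hlog
    _ ≤ Θ * F p := (hbd p hpp).le

/-- P3 (proved): `(p/log p) · log max(e, p·h) ≤ 3p · log max(e, h)`. -/
theorem numerics_prime {p : ℕ} (hp : p.Prime) (h : ℝ) :
    (p : ℝ) / Real.log p * Real.log (max (Real.exp 1) (p * h)) ≤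
      3 * p * Real.log (max (Real.exp 1) h) := by
  have hp1 : (1 : ℝ) ≤ p := by exact_mod_cast hp.one_lt.le
  have hp2 : (2 : ℝ) ≤ p := by exact_mod_cast hp.two_le
  have hpl : 0 ≤ (p : ℝ) / Real.log p := div_nonneg (by linarith) (Real.log_nonneg hp1)
  calc (p : ℝ) / Real.log p * Real.log (max (Real.exp 1) (p * h))
      ≤ (p : ℝ) / Real.log p * (Real.log p + Real.log (max (Real.exp 1) h)) :=
        mul_le_mul_of_nonneg_left (log_max_exp_mul_le hp1) hpl
    _ ≤ 3 * p * Real.log (max (Real.exp 1) h) := div_log_mul_add_le hp2 (one_le_log_max_exp h)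

/-- C1 (proved): p-adic clause summed over `p ∣ u`: `log|u| ≤ 3 · Θ₀ · Y · Σ_{p ∣ u} p`. -/
theorem cusp0_padic {K : ℝ} (hK : 1 ≤ K) (hP : PastenApproximationBound K) {u w : ℤ}
    (h : IsCoprime u w) (h0 : u * w * Q u w ≠ 0) (hne : u - 11 * w ≠ 0) :
    Real.log |(u : ℝ)| ≤ 3 * Th K u w * Yxi u w * ∑ p ∈ u.natAbs.primeFactors, (p : ℝ) := by
  obtain ⟨huw, _⟩ := mul_ne_zero_iff.mp h0
  obtain ⟨hu, _⟩ := mul_ne_zero_iff.mp huw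
  have hC := (cusp0_call hK hP h h0 hne).2
  have hΘ : 0 ≤ Th K u w := theta_nonneg (zero_le_one.trans hK) _ _ _
  have key := log_natAbs_le_of_padic hu (ξ := xiU u w) (Θ := Th K u w)
    (F := fun p => 3 * (p : ℝ) * Yxi u w)
    (fun p hp => factorization_le_padicValRat_xiU h h0 hne hp)
    (fun p hp => (hC p hp).trans_le (mul_le_mul_of_nonneg_left (numerics_prime hp _) hΘ))
  calc Real.log |(u : ℝ)| ≤ Th K u w * ∑ p ∈ u.natAbs.primeFactors, 3 * (p : ℝ) * Yxi u w := key
    _ = 3 * Th K u w * Yxi u w * ∑ p ∈ u.natAbs.primeFactors, (p : ℝ) := by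
      rw [Finset.mul_sum, Finset.mul_sum]
      exact Finset.sum_congr rfl fun p _ => by ring

/-- C2 (proved): `|1 − ξ₀| = |u|·|u − 11w| / w² ≤ 12|u|/|w|` when `|u| ≤ |w|`. -/
theorem abs_one_sub_xiU_le {u w : ℤ} (h0 : u * w * Q u w ≠ 0) (hle : |(u : ℝ)| ≤ |(w : ℝ)|) :
    |((1 - xiU u w : ℚ) : ℝ)| ≤ 12 * |(u : ℝ)| / |(w : ℝ)| := by
  obtain ⟨huw, _⟩ := mul_ne_zero_iff.mp h0
  obtain ⟨hu, hw⟩ := mul_ne_zero_iff.mp huw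
  have hwpos : 0 < |(w : ℝ)| := abs_pos.mpr (Int.cast_ne_zero.mpr hw)
  have h1 : ((1 - xiU u w : ℚ) : ℝ) = (u : ℝ) * ((u : ℝ) - 11 * (w : ℝ)) / (w : ℝ) ^ 2 := by
    rw [one_sub_xiU hw]; push_cast; ring
  rw [h1, abs_div, abs_mul, abs_pow, div_le_div_iff₀ (pow_pos hwpos 2) hwpos]
  have h2 : |(u : ℝ) - 11 * (w : ℝ)| ≤ 12 * |(w : ℝ)| := by
    calc |(u : ℝ) - 11 * (w : ℝ)| ≤ |(u : ℝ)| + |11 * (w : ℝ)| := abs_sub _ _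
      _ = |(u : ℝ)| + 11 * |(w : ℝ)| := by
          rw [abs_mul, abs_of_pos (by norm_num : (0 : ℝ) < 11)]
      _ ≤ 12 * |(w : ℝ)| := by linarith
  have hu0 : 0 ≤ |(u : ℝ)| := abs_nonneg _
  calc |(u : ℝ)| * |(u : ℝ) - 11 * (w : ℝ)| * |(w : ℝ)|
      ≤ |(u : ℝ)| * (12 * |(w : ℝ)|) * |(w : ℝ)| :=
        mul_le_mul_of_nonneg_right (mul_le_mul_of_nonneg_left h2 hu0) hwpos.le
    _ = 12 * |(u : ℝ)| * |(w : ℝ)| ^ 2 := by ring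

/-- C3 (proved, REGIME-FREE transfer): `log H ≤ log|u| + log 12 + Θ₀ · Y`. -/
theorem cusp0_transfer {K : ℝ} (hK : 1 ≤ K) (hP : PastenApproximationBound K) {u w : ℤ}
    (h : IsCoprime u w) (h0 : u * w * Q u w ≠ 0) (hne : u - 11 * w ≠ 0) :
    Real.log (H u w) ≤ Real.log |(u : ℝ)| + Real.log 12 + Th K u w * Yxi u w := by
  obtain ⟨huw, _⟩ := mul_ne_zero_iff.mp h0
  obtain ⟨hu, hw⟩ := mul_ne_zero_iff.mp huw
  have hΘ : 0 ≤ Th K u w := theta_nonneg (zero_le_one.trans hK) _ _ _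
  have hY : 0 ≤ Yxi u w := zero_le_one.trans (one_le_log_max_exp _)
  have hΘY : 0 ≤ Th K u w * Yxi u w := mul_nonneg hΘ hY
  have hu1 : (1 : ℝ) ≤ |(u : ℝ)| := by exact_mod_cast Int.one_le_abs hu
  have hlog12 : 0 ≤ Real.log 12 := Real.log_nonneg (by norm_num)
  rcases le_or_gt |(w : ℝ)| |(u : ℝ)| with hle | hlt
  · have hH : H u w = |(u : ℝ)| := max_eq_left hle
    rw [hH]; linarith
  · have hH : H u w = |(w : ℝ)| := max_eq_right hlt.le
    have h1 := (cusp0_call hK hP h h0 hne).1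
    have h2 := abs_one_sub_xiU_le h0 hlt.le
    have hne1 : (1 : ℚ) - xiU u w ≠ 0 := sub_ne_zero.mpr (xiU_ne_one h0 hne).symm
    have hpos : 0 < |((1 - xiU u w : ℚ) : ℝ)| := abs_pos.mpr (by exact_mod_cast hne1)
    have hwpos : 0 < |(w : ℝ)| := by linarith
    have h12u : (12 * |(u : ℝ)|) ≠ 0 := by positivity
    have h3 : Real.log |((1 - xiU u w : ℚ) : ℝ)| ≤
        Real.log 12 + Real.log |(u : ℝ)| - Real.log |(w : ℝ)| := by
      have := Real.log_le_log hpos h2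
      rw [Real.log_div h12u hwpos.ne', Real.log_mul (by norm_num) (by positivity)] at this
      exact this
    rw [hH]; linarith

/-- C4 (proved): the one-cusp pre-bound before absorption. -/
theorem cusp0_pre {K : ℝ} (hK : 1 ≤ K) (hP : PastenApproximationBound K) {u w : ℤ}
    (h : IsCoprime u w) (h0 : u * w * Q u w ≠ 0) (hne : u - 11 * w ≠ 0) :
    Real.log (H u w) ≤
      Real.log 12 + Th K u w * Yxi u w * (1 + 3 * ∑ p ∈ u.natAbs.primeFactors, (p : ℝ)) := by
  have h1 := cusp0_padic hK hP h h0 hne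
  have h2 := cusp0_transfer hK hP h h0 hne
  have h3 : Th K u w * Yxi u w * (1 + 3 * ∑ p ∈ u.natAbs.primeFactors, (p : ℝ)) =
      Th K u w * Yxi u w + 3 * Th K u w * Yxi u w * ∑ p ∈ u.natAbs.primeFactors, (p : ℝ) := by ring
  linarith

/-! ## 4 · FILE C, part 1 (absorption): `h(ξ₀) ≤ 2y`, `Θ₀ ≪ R^η`, `Σ p ≤ rad u` -/

/-- Y1 (proved): `h(ξ₀) ≤ log|Q| + log w² ≤ 2 log(13H²) = 2y`. -/
theorem logHeight₁_xiU_le {u w : ℤ} (h0 : u * w * Q u w ≠ 0) :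
    logHeight₁ (xiU u w) ≤ 2 * Ylin u w := by
  obtain ⟨huw, hQ⟩ := mul_ne_zero_iff.mp h0
  obtain ⟨hu, hw⟩ := mul_ne_zero_iff.mp huw
  have hx : (Q u w).natAbs ≠ 0 := Int.natAbs_ne_zero.mpr hQ
  have hy : w.natAbs ^ 2 ≠ 0 := pow_ne_zero _ (Int.natAbs_ne_zero.mpr hw)
  have h1 : logHeight₁ (xiU u w) ≤
      Real.log (((Q u w).natAbs : ℕ) : ℝ) + Real.log (((w.natAbs ^ 2 : ℕ)) : ℝ) :=
    logHeight₁_sign_mul_div_le hx hy (neg_sgn_cases hQ)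
  have e1 : (((Q u w).natAbs : ℕ) : ℝ) = |((Q u w : ℤ) : ℝ)| := by
    rw [Nat.cast_natAbs, Int.cast_abs]
  have e2 : ((w.natAbs ^ 2 : ℕ) : ℝ) = |(w : ℝ)| ^ 2 := by
    rw [Nat.cast_pow, Nat.cast_natAbs, Int.cast_abs]
  have eQ : ((Q u w : ℤ) : ℝ) = (u : ℝ) ^ 2 - 11 * (u : ℝ) * (w : ℝ) - (w : ℝ) ^ 2 := by
    simp only [Q]; push_cast; ring
  have ha : |(u : ℝ)| ≤ H u w := le_max_left _ _
  have hb : |(w : ℝ)| ≤ H u w := le_max_right _ _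
  have ha0 : 0 ≤ |(u : ℝ)| := abs_nonneg _
  have hb0 : 0 ≤ |(w : ℝ)| := abs_nonneg _
  have hH0 : 0 ≤ H u w := ha0.trans ha
  have hp1 : |(u : ℝ)| ^ 2 ≤ H u w ^ 2 := pow_le_pow_left₀ ha0 ha 2
  have hp2 : |(u : ℝ)| * |(w : ℝ)| ≤ H u w * H u w := mul_le_mul ha hb hb0 hH0
  have hp3 : |(w : ℝ)| ^ 2 ≤ H u w ^ 2 := pow_le_pow_left₀ hb0 hb 2
  have ht : |(u : ℝ) ^ 2 - 11 * (u : ℝ) * (w : ℝ) - (w : ℝ) ^ 2| ≤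
      |(u : ℝ)| ^ 2 + 11 * (|(u : ℝ)| * |(w : ℝ)|) + |(w : ℝ)| ^ 2 := by
    calc |(u : ℝ) ^ 2 - 11 * (u : ℝ) * (w : ℝ) - (w : ℝ) ^ 2|
        ≤ |(u : ℝ) ^ 2 - 11 * (u : ℝ) * (w : ℝ)| + |(w : ℝ) ^ 2| := abs_sub _ _
      _ ≤ (|(u : ℝ) ^ 2| + |11 * (u : ℝ) * (w : ℝ)|) + |(w : ℝ) ^ 2| :=
          add_le_add (abs_sub _ _) le_rfl
      _ = |(u : ℝ)| ^ 2 + 11 * (|(u : ℝ)| * |(w : ℝ)|) + |(w : ℝ)| ^ 2 := by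
          rw [abs_pow, abs_pow, abs_mul, abs_mul, abs_of_pos (by norm_num : (0 : ℝ) < 11)]; ring
  have hQabs : |((Q u w : ℤ) : ℝ)| ≤ 13 * H u w ^ 2 := by
    rw [eQ]; nlinarith [ht, hp1, hp2, hp3]
  have hw2 : |(w : ℝ)| ^ 2 ≤ 13 * H u w ^ 2 := by nlinarith [hp3, sq_nonneg (H u w)]
  have hQpos : 0 < |((Q u w : ℤ) : ℝ)| := abs_pos.mpr (by exact_mod_cast hQ)
  have hwpos : 0 < |(w : ℝ)| ^ 2 := pow_pos (abs_pos.mpr (Int.cast_ne_zero.mpr hw)) 2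
  have hl1 : Real.log (((Q u w).natAbs : ℕ) : ℝ) ≤ Ylin u w := by
    rw [e1]; exact Real.log_le_log hQpos hQabs
  have hl2 : Real.log (((w.natAbs ^ 2 : ℕ)) : ℝ) ≤ Ylin u w := by
    rw [e2]; exact Real.log_le_log hwpos hw2
  linarith

/-- Y1' (proved): hence `Y ≤ log max(e, 2y)`. -/
theorem Yxi_le {u w : ℤ} (h0 : u * w * Q u w ≠ 0) :
    Yxi u w ≤ Real.log (max (Real.exp 1) (2 * Ylin u w)) :=
  log_max_exp_mono (logHeight₁_xiU_le h0)

/-- T0 (proved, radical bookkeeping): `rad(|Q|, |w|², |u|) = rad(u·w·Q)` as natural numbers. -/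
theorem rad_aux_eq {u w : ℤ} (h0 : u * w * Q u w ≠ 0) :
    rad (Q u w).natAbs (w.natAbs ^ 2) u.natAbs =
      (UniqueFactorizationMonoid.radical (u * w * Q u w)).natAbs := by
  obtain ⟨huw, hQ⟩ := mul_ne_zero_iff.mp h0
  obtain ⟨hu, hw⟩ := mul_ne_zero_iff.mp huw
  have hu' := Int.natAbs_ne_zero.mpr hu
  have hw' := Int.natAbs_ne_zero.mpr hw
  have hQ' := Int.natAbs_ne_zero.mpr hQ
  rw [rad_def, natAbs_radical, Int.natAbs_mul, Int.natAbs_mul, Nat.radical_eq_prod_primeFactors,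
    Nat.radical_eq_prod_primeFactors]
  have hpf : ((Q u w).natAbs * w.natAbs ^ 2 * u.natAbs).primeFactors =
      (u.natAbs * w.natAbs * (Q u w).natAbs).primeFactors := by
    rw [Nat.primeFactors_mul (mul_ne_zero hQ' (pow_ne_zero _ hw')) hu',
      Nat.primeFactors_mul hQ' (pow_ne_zero _ hw'), Nat.primeFactors_pow _ two_ne_zero,
      Nat.primeFactors_mul (mul_ne_zero hu' hw') hQ', Nat.primeFactors_mul hu' hw']
    ext p
    simp only [Finset.mem_union]
    tauto
  rw [hpf]

/-- T1 (proved): `Θ₀ ≤ K · C · R^η` — ONE tree call of `SingleTowerSzpiroLine.theta_zero_le_mul_rpow` + T0. -/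
theorem theta_cusp0_le {K C η : ℝ} (hK : 1 ≤ K) (hη : 0 ≤ η)
    (hC : ∀ S : Finset ℕ, (∀ p ∈ S, p.Prime) → ∏ p ∈ S, K * Real.log p / (p : ℝ) ^ η ≤ C)
    {u w : ℤ} (h : IsCoprime u w) (h0 : u * w * Q u w ≠ 0) :
    Th K u w ≤ K * C * Rr u w ^ η := by
  obtain ⟨huw, hQ⟩ := mul_ne_zero_iff.mp h0
  obtain ⟨hu, hw⟩ := mul_ne_zero_iff.mp huw
  have hx : (Q u w).natAbs ≠ 0 := Int.natAbs_ne_zero.mpr hQ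
  have hy : w.natAbs ^ 2 ≠ 0 := pow_ne_zero _ (Int.natAbs_ne_zero.mpr hw)
  have hu' : u.natAbs ≠ 0 := Int.natAbs_ne_zero.mpr hu
  have key := SingleTowerSzpiroLine.theta_zero_le_mul_rpow hK hη hC hx hy (coprime_xy_u h)
    (dvd_mul_right ((Q u w).natAbs * w.natAbs ^ 2) u.natAbs)
    (mul_ne_zero (mul_ne_zero hx hy) hu')
  rw [rad_aux_eq h0] at key
  exact key

/-- J3 (proved): `1 + 3 Σ_{p ∣ u} p ≤ 4 · rad u` (`sum_le_prod_of_two_le`, H0, H1). -/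
theorem one_add_three_sum_le (u : ℤ) :
    1 + 3 * ∑ p ∈ u.natAbs.primeFactors, (p : ℝ) ≤ 4 * radR u := by
  have h1 := one_le_radR u
  have h2 : ∑ p ∈ u.natAbs.primeFactors, (p : ℝ) ≤ radR u := by
    rw [natAbs_radical_cast]
    have h3 := sum_le_prod_of_two_le (s := u.natAbs.primeFactors)
      (fun p hp => (Nat.prime_of_mem_primeFactors hp).two_le)
    have h4 : ((∑ p ∈ u.natAbs.primeFactors, p : ℕ) : ℝ) ≤ ((∏ p ∈ u.natAbs.primeFactors, p : ℕ) : ℝ) := by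
      exact_mod_cast h3
    rw [Nat.cast_sum, Nat.cast_prod] at h4
    exact h4
  linarith


end CuspFieldPencilGoldenCuspShadow

end Summit.ABC.ABC.Theorems

end


/-! ===== LANDING PART 3/3 — target `Summits/ABC/ABC/Theorems/CuspFieldPencilGoldenCuspShadow.lean` — its own header is exactly:
    import Summits.ABC.ABC.Theses.CuspFieldPencil
    import Summits.ABC.ABC.Theorems.CuspFieldPencilGoldenCuspShadowCall
    import Summits.ABC.ABC.Theorems.YuMatveevShapeRatCloses
    import HarnessLib
===== (cut here; everything down to the next PART marker is the file body) -/

/-!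
# Crux X1 `GoldenCuspShadow` (stmt-ABC-26026) — part 3/3: pre-bound, endgame call, swap, `min`, and the CRUX

UNCONDITIONAL: the only external input is the kernel theorem
`Summit.ABC.ABC.Theorems.approximationBound_rat_holds : ∃ K ≥ 1, PastenApproximationBound K` (Baker–Pasten place
bounds over ℚ), run member-locally on the hidden triple `w² + Q = u(u−11w)` of the cusp form `Q = u² − 11uw − w²` of `X₁(5)`;
`min(rad u, rad w) ≤ R^{1/2}` turns the min-form into `log max(|u|,|w|) ≤ κ_ε · rad(uwQ)^{1/2+ε}`.
NOT abc, NOT A-PS: a class theorem for ONE binary quartic form. Verbatim from the `SplitK3G5` crux workfile.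
-/

set_option linter.dupNamespace false

noncomputable section

open Finset Real Height
open Literature.NumberTheory.DiophantineGeometry
open Literature.NumberTheory.DiophantineGeometry.Dioph
open Literature.NumberTheory.DiophantineGeometry.Pasten
open Literature.Barriers.ABC
open Summit.ABC.ABC.Theorems

namespace Summit.ABC.ABC.Theorems

namespace CuspFieldPencilGoldenCuspShadow

/-! ## 5 · FILE C, part 2: the linearised pre-bound, the endgame call, the swap, `min` -/

/-- G1 (proved): for every `η > 0` there is `A` (`:= log 1872 + 8KC`) with
`y ≤ A · R^η · rad u · log max(e, 2y)`, `y = log(13H²)`, for ALL coprime `(u, w)` with `uwQ ≠ 0`. -/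
theorem preRouteU {K : ℝ} (hK : 1 ≤ K) (hP : PastenApproximationBound K) {η : ℝ} (hη : 0 < η) :
    ∃ A : ℝ, ∀ u w : ℤ, IsCoprime u w → u * w * Q u w ≠ 0 →
      Ylin u w ≤ A * Rr u w ^ η * radR u * Real.log (max (Real.exp 1) (2 * Ylin u w)) := by
  have hK0 : 0 ≤ K := zero_le_one.trans hK
  obtain ⟨C, hC1, hC⟩ := SingleTowerSzpiroLine.exists_prod_mul_log_div_rpow_le (A := K) hK0 hη
  refine ⟨Real.log 1872 + 8 * K * C, fun u w h h0 => ?_⟩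
  obtain ⟨huw, hQ⟩ := mul_ne_zero_iff.mp h0
  obtain ⟨hu, hw⟩ := mul_ne_zero_iff.mp huw
  have hu1 : (1 : ℝ) ≤ |(u : ℝ)| := by exact_mod_cast Int.one_le_abs hu
  have hH : 1 ≤ H u w := hu1.trans (le_max_left _ _)
  have hR : 1 ≤ Rr u w := one_le_radR _
  have hru : 1 ≤ radR u := one_le_radR u
  have hRη0 : 0 ≤ Rr u w ^ η := Real.rpow_nonneg (zero_le_one.trans hR) _
  have hRη : 1 ≤ Rr u w ^ η := Real.one_le_rpow hR hη.le
  have hL : 1 ≤ Real.log (max (Real.exp 1) (2 * Ylin u w)) := one_le_log_max_exp _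
  have h1872 : 0 ≤ Real.log 1872 := Real.log_nonneg (by norm_num)
  have hKC : 0 ≤ 8 * K * C := mul_nonneg (mul_nonneg (by norm_num) hK0) (zero_le_one.trans hC1)
  have hX : 1 ≤ Rr u w ^ η * radR u * Real.log (max (Real.exp 1) (2 * Ylin u w)) :=
    one_le_mul_of_one_le_of_one_le (one_le_mul_of_one_le_of_one_le hRη hru) hL
  have hA1 : Real.log 1872 * 1 ≤
      Real.log 1872 * (Rr u w ^ η * radR u * Real.log (max (Real.exp 1) (2 * Ylin u w))) :=
    mul_le_mul_of_nonneg_left hX h1872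
  have hA2 : (8 * K * C) * 1 ≤
      (8 * K * C) * (Rr u w ^ η * radR u * Real.log (max (Real.exp 1) (2 * Ylin u w))) :=
    mul_le_mul_of_nonneg_left hX hKC
  by_cases hne : u - 11 * w = 0
  · -- the escape `(u, w) = ±(11, 1)`: `y = log 1573 ≤ log 1872`
    have hH11 : H u w = 11 := escape_u h hne
    have hY : Ylin u w ≤ Real.log 1872 := by
      show Real.log (13 * H u w ^ 2) ≤ Real.log 1872
      rw [hH11]; exact Real.log_le_log (by norm_num) (by norm_num)
    linarith
  · have h4 := cusp0_pre hK hP h h0 hne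
    have hT := theta_cusp0_le hK hη.le hC h h0
    have hJ := one_add_three_sum_le u
    have hYx := Yxi_le h0
    have hΘ : 0 ≤ Th K u w := theta_nonneg hK0 _ _ _
    have hYxi0 : 0 ≤ Yxi u w := zero_le_one.trans (one_le_log_max_exp _)
    have hS0 : 0 ≤ 1 + 3 * ∑ p ∈ u.natAbs.primeFactors, (p : ℝ) := by positivity
    have hKCR : 0 ≤ K * C * Rr u w ^ η := mul_nonneg (mul_nonneg hK0 (zero_le_one.trans hC1)) hRη0
    have hKCR4 : 0 ≤ K * C * Rr u w ^ η * (4 * radR u) :=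
      mul_nonneg hKCR (mul_nonneg (by norm_num) (Nat.cast_nonneg _))
    have eY : Ylin u w = Real.log 13 + 2 * Real.log (H u w) := by
      show Real.log (13 * H u w ^ 2) = _
      rw [Real.log_mul (by norm_num) (pow_pos (one_pos.trans_le hH) 2).ne', Real.log_pow]
      push_cast; ring
    have e1872 : Real.log 13 + 2 * Real.log 12 = Real.log 1872 := by
      have : (1872 : ℝ) = 13 * 12 ^ 2 := by norm_num
      rw [this, Real.log_mul (by norm_num) (by norm_num), Real.log_pow]; push_cast; ring
    have step2 : Th K u w * (1 + 3 * ∑ p ∈ u.natAbs.primeFactors, (p : ℝ)) ≤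
        K * C * Rr u w ^ η * (4 * radR u) := mul_le_mul hT hJ hS0 hKCR
    have step3 : Th K u w * (1 + 3 * ∑ p ∈ u.natAbs.primeFactors, (p : ℝ)) * Yxi u w ≤
        K * C * Rr u w ^ η * (4 * radR u) * Real.log (max (Real.exp 1) (2 * Ylin u w)) :=
      mul_le_mul step2 hYx hYxi0 hKCR4
    nlinarith [h4, step3, eY, e1872, hA1, hA2]

/-- The admissible pairs, as an index type for `endgame_abstract`. -/
abbrev Adm : Type := {q : ℤ × ℤ // IsCoprime q.1 q.2 ∧ q.1 * q.2 * Q q.1 q.2 ≠ 0}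

/-- G2 (proved): on admissible pairs `0 ≤ y`, `1 ≤ R`, `1 ≤ rad u ≤ R`. -/
theorem adm_bounds (i : Adm) :
    0 ≤ Ylin i.1.1 i.1.2 ∧ 1 ≤ Rr i.1.1 i.1.2 ∧ 1 ≤ radR i.1.1 ∧ radR i.1.1 ≤ Rr i.1.1 i.1.2 := by
  obtain ⟨⟨u, w⟩, h, h0⟩ := i
  obtain ⟨huw, hQ⟩ := mul_ne_zero_iff.mp h0
  obtain ⟨hu, hw⟩ := mul_ne_zero_iff.mp huw
  dsimp only
  have hu1 : (1 : ℝ) ≤ |(u : ℝ)| := by exact_mod_cast Int.one_le_abs hu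
  have hH : 1 ≤ H u w := hu1.trans (le_max_left _ _)
  refine ⟨?_, one_le_radR _, one_le_radR u, ?_⟩
  · exact Real.log_nonneg (by nlinarith)
  · rw [Rr_eq h]
    have h1 := one_le_radR u
    have h2 := one_le_radR w
    have h3 := one_le_radR (Q u w)
    calc radR u = radR u * 1 * 1 := by ring
      _ ≤ radR u * radR w * radR (Q u w) :=
        mul_le_mul (mul_le_mul_of_nonneg_left h2 (by linarith)) h3 zero_le_one
          (mul_nonneg (by linarith) (by linarith))

/-- G3 (proved): `RouteU` — unpack the endgame over `Adm` and use `log H ≤ y`. -/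
theorem routeU_of_pasten {K : ℝ} (hK : 1 ≤ K) (hP : PastenApproximationBound K) : RouteU := by
  have hE := endgame_abstract (ι := Adm) (y := fun i => Ylin i.1.1 i.1.2) (R := fun i => Rr i.1.1 i.1.2)
    (m := fun i => radR i.1.1) (fun i => (adm_bounds i).1) (fun i => (adm_bounds i).2.1)
    (fun i => (adm_bounds i).2.2.1) (fun i => (adm_bounds i).2.2.2)
    (fun η hη => by
      obtain ⟨A, hA⟩ := preRouteU hK hP hη
      exact ⟨A, fun i => hA i.1.1 i.1.2 i.2.1 i.2.2⟩)
  intro ε hε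
  obtain ⟨κ, hκ⟩ := hE ε hε
  refine ⟨κ, fun u w h h0 => ?_⟩
  have key := hκ ⟨(u, w), h, h0⟩
  have hH1 : 1 ≤ H u w := by
    obtain ⟨huw, _⟩ := mul_ne_zero_iff.mp h0
    obtain ⟨hu, _⟩ := mul_ne_zero_iff.mp huw
    have : (1 : ℝ) ≤ |(u : ℝ)| := by exact_mod_cast Int.one_le_abs hu
    exact this.trans (le_max_left _ _)
  have hlog : Real.log (H u w) ≤ Ylin u w := by
    apply Real.log_le_log (by linarith)
    nlinarith
  exact hlog.trans key

/-- G4 (proved, the cusp swap `t ↦ −1/t`): `RouteU → RouteW` by applying `RouteU` to `(w, −u)`. -/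
theorem routeW_of_routeU : RouteU → RouteW := by
  intro hU ε hε
  obtain ⟨κ, hκ⟩ := hU ε hε
  refine ⟨κ, fun u w h h0 => ?_⟩
  have h' : IsCoprime w (-u) := h.symm.neg_right
  have e1 : w * -u * (w ^ 2 - 11 * w * -u - (-u) ^ 2) = u * w * (u ^ 2 - 11 * u * w - w ^ 2) := by
    ring
  have h0' : w * -u * (w ^ 2 - 11 * w * -u - (-u) ^ 2) ≠ 0 := by rw [e1]; exact h0
  have key := hκ w (-u) h' h0'
  have e2 : max |((w : ℤ) : ℝ)| |((-u : ℤ) : ℝ)| = max |((u : ℤ) : ℝ)| |((w : ℤ) : ℝ)| := by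
    rw [Int.cast_neg, abs_neg, max_comm]
  rw [e1, e2] at key
  exact key

/-- R0 (proved): the two one-cusp bounds give the min-form with `κ = max (max κ_U κ_W) 0`. -/
theorem cuspMinRadBound_of_routes : RouteU → RouteW → CuspMinRadBound := by
  intro hU hW ε hε
  obtain ⟨κ₁, h₁⟩ := hU ε hε
  obtain ⟨κ₂, h₂⟩ := hW ε hε
  refine ⟨max (max κ₁ κ₂) 0, fun u w h h0 => ?_⟩
  have hK1 : κ₁ ≤ max (max κ₁ κ₂) 0 := le_max_of_le_left (le_max_left _ _)
  have hK2 : κ₂ ≤ max (max κ₁ κ₂) 0 := le_max_of_le_left (le_max_right _ _)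
  have hX : (0 : ℝ) ≤ Rr u w ^ (ε : ℝ) := Real.rpow_nonneg (Nat.cast_nonneg _) _
  show Real.log (H u w) ≤ max (max κ₁ κ₂) 0 * Rr u w ^ (ε : ℝ) * min (radR u) (radR w)
  rcases min_choice (radR u) (radR w) with hm | hm <;> rw [hm]
  · exact (h₁ u w h h0).trans
      (mul_le_mul_of_nonneg_right (mul_le_mul_of_nonneg_right hK1 hX) (Nat.cast_nonneg _))
  · exact (h₂ u w h h0).trans
      (mul_le_mul_of_nonneg_right (mul_le_mul_of_nonneg_right hK2 hX) (Nat.cast_nonneg _))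

/-- real-analysis helper (proved): for `x, y, z ≥ 1`, `min x y ≤ (x y)^{2/3} · z^{1/3}`
(`min³ ≤ (xy)²` by `min ≤ xy`, `min² ≤ xy`; cube root; `1 ≤ z^{1/3}`). -/
theorem min_le_rpow23 {x y z : ℝ} (hx : 1 ≤ x) (hy : 1 ≤ y) (hz : 1 ≤ z) :
    min x y ≤ (x * y) ^ (2 / 3 : ℝ) * z ^ (1 / 3 : ℝ) := by
  obtain ⟨m, hmdef⟩ : ∃ m : ℝ, m = min x y := ⟨_, rfl⟩
  rw [← hmdef]
  have hm1 : 1 ≤ m := by rw [hmdef]; exact le_min hx hy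
  have hm0 : 0 ≤ m := zero_le_one.trans hm1
  have hmx : m ≤ x := by rw [hmdef]; exact min_le_left _ _
  have hmy : m ≤ y := by rw [hmdef]; exact min_le_right _ _
  have hxy0 : 0 ≤ x * y := by nlinarith
  have hP : m ^ 2 ≤ x * y := by nlinarith [mul_le_mul hmx hmy hm0 (zero_le_one.trans hx)]
  have hP1 : m ≤ x * y := by nlinarith
  have h3 : m ^ 3 ≤ (x * y) ^ 2 := by nlinarith [mul_le_mul hP1 hP (by positivity) hxy0]
  have h5 : (m ^ 3) ^ ((3 : ℕ)⁻¹ : ℝ) ≤ ((x * y) ^ 2) ^ ((3 : ℕ)⁻¹ : ℝ) :=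
    Real.rpow_le_rpow (by positivity) h3 (by positivity)
  rw [Real.pow_rpow_inv_natCast hm0 (by norm_num)] at h5
  have h6 : ((x * y) ^ 2) ^ ((3 : ℕ)⁻¹ : ℝ) = (x * y) ^ (2 / 3 : ℝ) := by
    rw [← Real.rpow_natCast (x * y) 2, ← Real.rpow_mul hxy0]
    norm_num
  have h7 : 1 ≤ z ^ (1 / 3 : ℝ) := Real.one_le_rpow hz (by norm_num)
  have h8 : 0 ≤ (x * y) ^ (2 / 3 : ℝ) := Real.rpow_nonneg hxy0 _
  calc m = m * 1 := (mul_one m).symm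
    _ ≤ (x * y) ^ (2 / 3 : ℝ) * z ^ (1 / 3 : ℝ) := mul_le_mul (h5.trans_eq h6) h7 zero_le_one h8

/-- real-analysis helper (proved): for `x, y, z ≥ 1`, `min x y ≤ (x y z)^{1/2}`. -/
theorem min_le_rpow_half {x y z : ℝ} (hx : 1 ≤ x) (hy : 1 ≤ y) (hz : 1 ≤ z) :
    min x y ≤ (x * y * z) ^ (1 / 2 : ℝ) := by
  obtain ⟨m, hmdef⟩ : ∃ m : ℝ, m = min x y := ⟨_, rfl⟩
  rw [← hmdef]
  have hm1 : 1 ≤ m := by rw [hmdef]; exact le_min hx hy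
  have hm0 : 0 ≤ m := zero_le_one.trans hm1
  have hmx : m ≤ x := by rw [hmdef]; exact min_le_left _ _
  have hmy : m ≤ y := by rw [hmdef]; exact min_le_right _ _
  have hxy0 : 0 ≤ x * y := by nlinarith
  have hP : m ^ 2 ≤ x * y * z := by
    nlinarith [mul_le_mul hmx hmy hm0 (zero_le_one.trans hx), mul_le_mul_of_nonneg_left hz hxy0]
  have h5 : (m ^ 2) ^ ((2 : ℕ)⁻¹ : ℝ) ≤ (x * y * z) ^ ((2 : ℕ)⁻¹ : ℝ) :=
    Real.rpow_le_rpow (by positivity) hP (by positivity)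
  rw [Real.pow_rpow_inv_natCast hm0 (by norm_num)] at h5
  have h6 : (x * y * z) ^ ((2 : ℕ)⁻¹ : ℝ) = (x * y * z) ^ (1 / 2 : ℝ) := by norm_num
  exact h5.trans_eq h6

/-- R1 (proved): min-form ⇒ STUB (`min ≤ (rad u rad w)^{2/3} (rad Q)^{1/3}`, `κ ↦ max κ 0`). -/
theorem stubSplit_of_cuspMinRadBound : CuspMinRadBound → StubSplit := by
  intro hmin ε hε
  obtain ⟨κ, hκ⟩ := hmin ε hε
  refine ⟨max κ 0, fun u w h h0 => ?_⟩
  have key := hκ u w h h0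
  have hk : κ ≤ max κ 0 := le_max_left _ _
  have hX : (0 : ℝ) ≤ Rr u w ^ (ε : ℝ) := Real.rpow_nonneg (Nat.cast_nonneg _) _
  have hM : (0 : ℝ) ≤ min (radR u) (radR w) :=
    le_min (zero_le_one.trans (one_le_radR u)) (zero_le_one.trans (one_le_radR w))
  have hm := min_le_rpow23 (one_le_radR u) (one_le_radR w) (one_le_radR (Q u w))
  have hk0 : 0 ≤ max κ 0 * Rr u w ^ (ε : ℝ) := mul_nonneg (le_max_right _ _) hX
  calc Real.log (H u w) ≤ κ * Rr u w ^ (ε : ℝ) * min (radR u) (radR w) := key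
    _ ≤ max κ 0 * Rr u w ^ (ε : ℝ) * min (radR u) (radR w) :=
        mul_le_mul_of_nonneg_right (mul_le_mul_of_nonneg_right hk hX) hM
    _ ≤ max κ 0 * Rr u w ^ (ε : ℝ) * ((radR u * radR w) ^ (2 / 3 : ℝ) * radR (Q u w) ^ (1 / 3 : ℝ)) :=
        mul_le_mul_of_nonneg_left hm hk0

/-! ## 6 · Assembly (sorry-free): helpers ⇒ RouteU ⇒ RouteW ⇒ min-form ⇒ stub and crux -/

/-- `RouteU` holds outright: the input is the kernel theorem `approximationBound_rat_holds`. -/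
theorem routeU_holds : RouteU := by
  obtain ⟨K, hK, hP⟩ := approximationBound_rat_holds
  exact routeU_of_pasten hK hP

/-- `RouteW` by the cusp swap. -/
theorem routeW_holds : RouteW :=
  routeW_of_routeU routeU_holds

/-- The min-form. -/
theorem cuspMinRadBound_holds : CuspMinRadBound :=
  cuspMinRadBound_of_routes routeU_holds routeW_holds

/-- THE STUB.  Land it with the VERBATIM registered header
`theorem stub_splitCuspTriple : <payload signature> := stubSplit_holds` (`--supports stmt-ABC-26026`). -/
theorem stubSplit_holds : StubSplit :=
  stubSplit_of_cuspMinRadBound cuspMinRadBound_holds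

end CuspFieldPencilGoldenCuspShadow

open CuspFieldPencilGoldenCuspShadow in
/-- **Crux X1 `GoldenCuspShadow` (stmt-ABC-26026) holds unconditionally**: for every `ε > 0` there is
`κ` with `log max(|u|,|w|) ≤ κ · rad(u·w·(u²−11uw−w²))^{1/2+ε}` for all coprime integers `u, w`
with `uw(u²−11uw−w²) ≠ 0`.  Input: the kernel theorem `approximationBound_rat_holds` (Baker–Pasten
place bounds over ℚ), run member-locally on the hidden triple `w² + Q = u(u−11w)`. -/
theorem goldenCuspShadow_proof : Summit.ABC.ABC.Theses.CuspFieldPencil.GoldenCuspShadow := by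
  intro ε hε
  obtain ⟨κ, hκ⟩ := cuspMinRadBound_holds ε hε
  refine ⟨max κ 0, fun u w h h0 => ?_⟩
  have key := hκ u w h h0
  have hk : κ ≤ max κ 0 := le_max_left _ _
  have hX : (0 : ℝ) ≤ Rr u w ^ (ε : ℝ) := Real.rpow_nonneg (Nat.cast_nonneg _) _
  have hM : (0 : ℝ) ≤ min (radR u) (radR w) :=
    le_min (zero_le_one.trans (one_le_radR u)) (zero_le_one.trans (one_le_radR w))
  have hm : min (radR u) (radR w) ≤ Rr u w ^ (1 / 2 : ℝ) := by
    rw [Rr_eq h]; exact min_le_rpow_half (one_le_radR u) (one_le_radR w) (one_le_radR _)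
  have hR0 : 0 < Rr u w := one_pos.trans_le (one_le_radR _)
  have hk0 : 0 ≤ max κ 0 * Rr u w ^ (ε : ℝ) := mul_nonneg (le_max_right _ _) hX
  calc Real.log (H u w) ≤ κ * Rr u w ^ (ε : ℝ) * min (radR u) (radR w) := key
    _ ≤ max κ 0 * Rr u w ^ (ε : ℝ) * min (radR u) (radR w) :=
        mul_le_mul_of_nonneg_right (mul_le_mul_of_nonneg_right hk hX) hM
    _ ≤ max κ 0 * Rr u w ^ (ε : ℝ) * Rr u w ^ (1 / 2 : ℝ) := mul_le_mul_of_nonneg_left hm hk0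
    _ = max κ 0 * Rr u w ^ (1 / 2 + ε : ℝ) := by
        rw [Real.rpow_add hR0]; ring

end Summit.ABC.ABC.Theorems

end
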